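import Summits.QuantumFields.BalabanUV.T4Continuum.Support.GradedWellConsistencyTransfer
import Summits.QuantumFields.BalabanUV.T4Continuum.Support.GradedWellResolventTower
import Summits.QuantumFields.BalabanUV.T4Continuum.Support.GradedWellGramTwoLevel
import Summits.QuantumFields.BalabanUV.T4Continuum.Support.GradedWellScalarCoercive

/-!
# T⁴ programme, spine node NE2 (U1a), sub-row Δ1 — THE GRADED WELL: THE (E2)-JUNCTION — the GW gauge-sandwich law `hSc` of the tower END
# `GradedWellConsistencyTransfer.towerLimitRate_GW_of_laws` FROM (GW-B) ALONE ((GW-K) and the column norms being theorems, (GW-Bᵗ) free)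

NE2 formalisation swarm `b2b-balaban-t4-ne2-formalise-*`, LEAF PROVER 06 (gen 8), item «(E2)-JUNCTION» (journal 2026-08-21, this seat's LANDED
line of p246846; owner R50 (f): «(E2) = (GW-B) [leaf-05] (∧ (GW-K) ✓)»).  In the vocabulary of the owner's file 4 `GradedWellTwoLevel`
(`BhGW`, `KGW`, `BhGWL`, `KGWL`, `rowSLift`) and file 5 `GradedWellResolventTower` (`JGW`, `opNorm_BhGW_le`, `opNorm_BhGWL_le`), with
leaf-05-g10's (GW-K) `GradedWellGram.opNorm_inv_gramK_GW_le` / `GradedWellGramTwoLevel.opNorm_inv_KGWL_sub_inv_KGW_le` and the owner's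
O16-e `GradedWellScalarCoercive.isUnit_det_DpGW` / `opNorm_GOmGW_le`:

 * §1 `SGW = localGW − regionGW = B_k·K_k⁻¹·B_kᴴ` and, at level `k+1` with level-`k` row indices, `= B′·K′⁻¹·B′ᴴ` (`SGW_eq_sandwich`,
   `SGW_succ_eq_sandwichL`);
 * §2 **`sandwich_comm_GW_le`**: `‖S_{k+1}J_k − J_kS_k‖ ≤ b′·ki·εB + (εB·ki + b·εK)·b` from the column law (B) `εB` and the Gram law (K) `εK`
   (`GradedWellTowerAssembly.opNorm_sandwich_comm_le_king` — (Bᵗ) free);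
 * §3 the numbers: `b = b′ = √(gamGW⁻¹)`, `ki = sigGW⁻²` (`‖(KGWL)⁻¹‖ = ‖(KGW(k+1))⁻¹‖` by relabelling), `εK = CkGW·L^{−k}` — all THEOREMS;
   **`sandwich_comm_GW_le_of_GWB`**: `‖S_{k+1}J_k − J_kS_k‖ ≤ CSGW·θ^k` given ONLY (GW-B) `‖B′ − J_kB_k‖ ≤ Cb·θ^k` (`L⁻¹ ≤ θ`);
 * §4 **`hSc_of_GWB`**: the 𝒢-sandwiched form `≤ Cst²·CSGW·θ^k` = the `hSc` slot of the END BY NAME;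
 * §5 **`towerLimitRate_GW_of_GWB`**: the graded-well tower END with `hSc` DISCHARGED modulo (GW-B): displayed inputs are now `hco`
   (⟸ (GW-W1)), `hE` (owner O17-a), `hMc` (graded-mass law, (E4)) and `hB` ((GW-B), leaf-05).

HONEST FRAMING (T4-DAG p. 1).  [folklore] bookkeeping over landed modules (model level: `U = 1`, one layer map on unit blocks with `layer ≤ m`,
`m` fixed, finite torus, operator norm); (GW-B), coercivity, `‖E‖ ≤ e`, the graded-mass law DISPLAYED; NOT a statement about Bałaban's
multi-region kernels; NE2 (U1a) NOT proved; spine PROVED 0/9 unchanged; NOT [B9] (3.16)/(3.23)–(3.27)/(3.42) as printed; NOT infinite volume /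
mass gap / Clay.  HONEST DEPENDENCY: continuum YM on T⁴ ⇐ BetaPertH ∧ nine spine estimates (0/9 proved); BetaPertH ⇐ (D1) ∧ (D4) ∧ CAP+tail;
G-an2-4 gates asym, D1 and NE2/3/4.  No `sorry`.
-/

noncomputable section

open scoped BigOperators ComplexConjugate Matrix Matrix.Norms.L2Operator

namespace Summit.QuantumFields.BalabanUV.T4Continuum.GradedWellSandwichLaw

open Literature.MathematicalPhysics.QuantumFieldTheory.Balaban1983to89.B5Prop11Plancherel (Tor fine Cst Cst_nonneg)
open Literature.MathematicalPhysics.QuantumFieldTheory.Balaban1983to89.B5G183RateUnitTower (lev lev_neZero)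
open Summit.QuantumFields.BalabanUV.T4Continuum
open Summit.QuantumFields.BalabanUV.T4Continuum.CovariantAveragingTower (TowerLimitRate)
open Summit.QuantumFields.BalabanUV.T4Continuum.BackgroundResolventTower
open Summit.QuantumFields.BalabanUV.T4Continuum.BalabanAveragedTowerUnit (idx Qlev)
open Summit.QuantumFields.BalabanUV.T4Continuum.SubtypeCompression (Coercive)
open Summit.QuantumFields.BalabanUV.T4Continuum.KingPairingPlantedLaw (JK JpcT calDalev)
open Summit.QuantumFields.BalabanUV.T4Continuum.BalabanAveragedCoerciveTower (opNorm_submatrix_equiv)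
open Summit.QuantumFields.BalabanUV.T4Continuum.GradedWellData
open Summit.QuantumFields.BalabanUV.T4Continuum.GradedWellTorusTransfer (EGW)
open Summit.QuantumFields.BalabanUV.T4Continuum.GradedWellTwoLevel (rowSLift BhGW KGW BhGWL KGWL regionGW_succ_eq_localGW_sub_sandwichL
  regionGW_eq_localGW_sub_sandwich')
open Summit.QuantumFields.BalabanUV.T4Continuum.GradedWellResolventTower (JGW opNorm_BhGW_le opNorm_BhGWL_le)
open Summit.QuantumFields.BalabanUV.T4Continuum.GradedWellScalarCoercive (gamGW gamGW_pos isUnit_det_DpGW opNorm_GOmGW_le)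
open Summit.QuantumFields.BalabanUV.T4Continuum.GradedWellGram (sigGW sigGW_pos opNorm_inv_gramK_GW_le)
open Summit.QuantumFields.BalabanUV.T4Continuum.GradedWellGramTwoLevel (CkGW opNorm_inv_KGWL_sub_inv_KGW_le)
open Summit.QuantumFields.BalabanUV.T4Continuum.GradedWellTowerAssembly (opNorm_sandwich_comm_le_king)
open Summit.QuantumFields.BalabanUV.T4Continuum.GradedWellConsistencyTransfer (MGW SGW C1Tc C2GW regionGW_eq_lapV_add_mass_sub_sandwich
  opNorm_calDalev_sandwich_le towerLimitRate_GW_of_laws)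

variable {d : ℕ} (L : ℕ) [NeZero L] (M : Fin d → ℕ) [hM : ∀ μ, NeZero (M μ)] (k m : ℕ) (layer : Tor M → ℕ) (a a' : ℝ) (ha : 0 < a)

/-! ## §1 The GW gauge sandwich in the file-4 vocabulary -/

/-- `S_GW = localGW − regionGW`. [folklore] -/
theorem SGW_eq_localGW_sub : SGW L M k m layer a' = localGW L M k m layer a - regionGW L M k m layer a a' := by
  rw [regionGW_eq_lapV_add_mass_sub_sandwich L M k m layer a a', localGW_eq, MGW, sub_sub_cancel]

/-- **`S_GW(k) = B_k·K_k⁻¹·B_kᴴ`** (normalised rows). [folklore] -/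
theorem SGW_eq_sandwich :
    SGW L M k m layer a' = BhGW L M k m layer a' * (KGW L M k m layer a')⁻¹ * (BhGW L M k m layer a')ᴴ := by
  rw [SGW_eq_localGW_sub L M k m layer 0 a', regionGW_eq_localGW_sub_sandwich', sub_sub_cancel]

/-- **`S_GW(k+1) = B′·K′⁻¹·B′ᴴ`** with LEVEL-`k` row indices (`B′ = BhGWL`, `K′ = KGWL`). [folklore] -/
theorem SGW_succ_eq_sandwichL (hk : m ≤ k) :
    SGW L M (k + 1) m layer a'
      = BhGWL L M k m layer a' hk * (KGWL L M k m layer a' hk)⁻¹ * (BhGWL L M k m layer a' hk)ᴴ := by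
  rw [SGW_eq_localGW_sub L M (k + 1) m layer 0 a', regionGW_succ_eq_localGW_sub_sandwichL L M k m layer 0 a' hk, sub_sub_cancel]

/-! ## §2 The two-level law of the sandwich from (B) and (K) -/

/-- **THE GW GAUGE-SANDWICH LAW FROM THE COLUMN LAW AND THE GRAM LAW** ((Bᵗ) is free on the torus):
`‖S_{k+1}J_k − J_kS_k‖ ≤ b′·ki·εB + (εB·ki + b·εK)·b`. [folklore] -/
theorem sandwich_comm_GW_le (hk : m ≤ k) {b b' ki εB εK : ℝ} (hb : ‖BhGW L M k m layer a'‖ ≤ b)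
    (hb' : ‖BhGWL L M k m layer a' hk‖ ≤ b') (hki : ‖(KGWL L M k m layer a' hk)⁻¹‖ ≤ ki)
    (hB : ‖BhGWL L M k m layer a' hk - JGW L M k * BhGW L M k m layer a'‖ ≤ εB)
    (hK : ‖(KGWL L M k m layer a' hk)⁻¹ - (KGW L M k m layer a')⁻¹‖ ≤ εK)
    (hb0 : 0 ≤ b) (hb0' : 0 ≤ b') (hki0 : 0 ≤ ki) (hεB : 0 ≤ εB) :
    ‖SGW L M (k + 1) m layer a' * JpcT L M k - JpcT L M k * SGW L M k m layer a'‖ ≤ b' * ki * εB + (εB * ki + b * εK) * b := by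
  rw [SGW_succ_eq_sandwichL L M k m layer a' hk, SGW_eq_sandwich L M k m layer a']
  exact opNorm_sandwich_comm_le_king L M k (BhGW L M k m layer a') (BhGWL L M k m layer a' hk) ((KGW L M k m layer a')⁻¹)
    ((KGWL L M k m layer a' hk)⁻¹) hb hb' hki hB hK hb0 hb0' hki0 hεB

/-! ## §3 The numbers: column norms, Gram inverse norm, Gram law — all theorems -/

/-- `‖B_k‖ ≤ √(gamGW⁻¹)`. [folklore] -/
theorem opNorm_BhGW_le' (hlay : ∀ y, layer y ≤ m) (ha' : 0 < a') :
    ‖BhGW L M k m layer a'‖ ≤ Real.sqrt ((gamGW d m a')⁻¹) :=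
  (opNorm_BhGW_le L M k m layer a' ha'.le (isUnit_det_DpGW L M k m layer a' hlay ha')).trans
    (Real.sqrt_le_sqrt (opNorm_GOmGW_le L M k m layer a' hlay ha'))

/-- `‖B′‖ ≤ √(gamGW⁻¹)`. [folklore] -/
theorem opNorm_BhGWL_le' (hk : m ≤ k) (hlay : ∀ y, layer y ≤ m) (ha' : 0 < a') :
    ‖BhGWL L M k m layer a' hk‖ ≤ Real.sqrt ((gamGW d m a')⁻¹) :=
  (opNorm_BhGWL_le L M k m layer a' hk ha'.le (isUnit_det_DpGW L M (k + 1) m layer a' hlay ha')).trans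
    (Real.sqrt_le_sqrt (opNorm_GOmGW_le L M (k + 1) m layer a' hlay ha'))

/-- `‖K′⁻¹‖ = ‖K_{k+1}⁻¹‖ ≤ sigGW⁻²` (relabelling by `rowSLift`). [folklore] -/
theorem opNorm_inv_KGWL_le (hk : m ≤ k) (hlay : ∀ y, layer y ≤ m) (ha' : 0 < a') :
    ‖(KGWL L M k m layer a' hk)⁻¹‖ ≤ ((sigGW d L m a') ^ 2)⁻¹ := by
  unfold KGWL
  rw [Matrix.inv_submatrix_equiv, opNorm_submatrix_equiv]
  exact opNorm_inv_gramK_GW_le L M (k + 1) m layer a' (isUnit_det_DpGW L M (k + 1) m layer a' hlay ha') ha'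

/-- the Gram law (K) with the level-free cap `g = gamGW⁻¹`: `‖K′⁻¹ − K_k⁻¹‖ ≤ CkGW·L^{−k}`. [folklore] -/
theorem opNorm_inv_KGWL_sub_inv_KGW_le' (hk : m ≤ k) (hd : 1 ≤ d) (hlay : ∀ y, layer y ≤ m) (ha' : 0 < a') :
    ‖(KGWL L M k m layer a' hk)⁻¹ - (KGW L M k m layer a')⁻¹‖ ≤ CkGW d L m a' ((gamGW d m a')⁻¹) * ((L : ℝ)⁻¹) ^ k :=
  opNorm_inv_KGWL_sub_inv_KGW_le L M k m layer a' hk (Nat.pos_of_ne_zero (Nat.one_le_iff_ne_zero.mp hd)) ha'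
    (isUnit_det_DpGW L M k m layer a' hlay ha')
    (isUnit_det_DpGW L M (k + 1) m layer a' hlay ha') (opNorm_GOmGW_le L M k m layer a' hlay ha')
    (opNorm_GOmGW_le L M (k + 1) m layer a' hlay ha')

/-- the constant of the GW gauge-sandwich law given (GW-B)'s `Cb`: `b·ki·Cb + (Cb·ki + b·Ck)·b` with `b = √(gamGW⁻¹)`, `ki = sigGW⁻²`,
`Ck = CkGW(gamGW⁻¹)`. [folklore] -/
def CSGW (d L m : ℕ) (a' Cb : ℝ) : ℝ :=
  Real.sqrt ((gamGW d m a')⁻¹) * ((sigGW d L m a') ^ 2)⁻¹ * Cb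
    + (Cb * ((sigGW d L m a') ^ 2)⁻¹ + Real.sqrt ((gamGW d m a')⁻¹) * CkGW d L m a' ((gamGW d m a')⁻¹)) * Real.sqrt ((gamGW d m a')⁻¹)

/-- **THE GW GAUGE-SANDWICH LAW FROM (GW-B) ALONE** (`layer ≤ m`, `0 < a′`, `1 ≤ d`, `L⁻¹ ≤ θ`, `k ≥ m`):
`‖S_{k+1}J_k − J_kS_k‖ ≤ CSGW·θ^k`. [folklore] -/
theorem sandwich_comm_GW_le_of_GWB (hk : m ≤ k) (hd : 1 ≤ d) (hlay : ∀ y, layer y ≤ m) (ha' : 0 < a') {Cb θ : ℝ}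
    (hθ : (L : ℝ)⁻¹ ≤ θ) (hCb : 0 ≤ Cb) (hB : ‖BhGWL L M k m layer a' hk - JGW L M k * BhGW L M k m layer a'‖ ≤ Cb * θ ^ k) :
    ‖SGW L M (k + 1) m layer a' * JpcT L M k - JpcT L M k * SGW L M k m layer a'‖ ≤ CSGW d L m a' Cb * θ ^ k := by
  have hL0 : (0 : ℝ) ≤ (L : ℝ)⁻¹ := inv_nonneg.mpr (Nat.cast_nonneg L)
  have hθ0 : 0 ≤ θ := hL0.trans hθ
  have hp : ((L : ℝ)⁻¹) ^ k ≤ θ ^ k := pow_le_pow_left₀ hL0 hθ k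
  have hb0 : 0 ≤ Real.sqrt ((gamGW d m a')⁻¹) := Real.sqrt_nonneg _
  have hki0 : 0 ≤ ((sigGW d L m a') ^ 2)⁻¹ := inv_nonneg.mpr (sq_nonneg _)
  have hCk0 : 0 ≤ CkGW d L m a' ((gamGW d m a')⁻¹) := by
    have h := opNorm_inv_KGWL_sub_inv_KGW_le' L M m m layer a' le_rfl hd hlay ha'
    have hLm : 0 < ((L : ℝ)⁻¹) ^ m := pow_pos (inv_pos.mpr (by exact_mod_cast Nat.pos_of_ne_zero (NeZero.ne L))) m
    exact nonneg_of_mul_nonneg_left ((norm_nonneg _).trans h) hLm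
  have hK : ‖(KGWL L M k m layer a' hk)⁻¹ - (KGW L M k m layer a')⁻¹‖ ≤ CkGW d L m a' ((gamGW d m a')⁻¹) * θ ^ k :=
    (opNorm_inv_KGWL_sub_inv_KGW_le' L M k m layer a' hk hd hlay ha').trans (mul_le_mul_of_nonneg_left hp hCk0)
  have h := sandwich_comm_GW_le L M k m layer a' hk (opNorm_BhGW_le' L M k m layer a' hlay ha')
    (opNorm_BhGWL_le' L M k m layer a' hk hlay ha') (opNorm_inv_KGWL_le L M k m layer a' hk hlay ha') hB hK hb0 hb0 hki0
    (mul_nonneg hCb (pow_nonneg hθ0 k))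
  refine h.trans (le_of_eq ?_)
  unfold CSGW
  ring

/-! ## §4 The `hSc` slot of the END, from (GW-B) -/

/-- **THE 𝒢-SANDWICHED GW GAUGE-SANDWICH LAW FROM (GW-B)**: `‖𝒢^{(k+1)}(S_{k+1}J_k − J_kS_k)𝒢^{(k)}‖ ≤ Cst²·CSGW·θ^k` — the `hSc`
hypothesis of `GradedWellConsistencyTransfer.towerLimitRate_GW_of_laws` BY NAME. [folklore] -/
theorem hSc_of_GWB (hd : 1 ≤ d) (hlay : ∀ y, layer y ≤ m) (ha' : 0 < a') {Cb θ : ℝ} (hθ : (L : ℝ)⁻¹ ≤ θ) (hCb : 0 ≤ Cb)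
    (hB : ∀ k (hk : m ≤ k), ‖BhGWL L M k m layer a' hk - JGW L M k * BhGW L M k m layer a'‖ ≤ Cb * θ ^ k)
    (k : ℕ) (hk : m ≤ k) :
    ‖(calDalev L M a ha (k + 1))⁻¹ * (SGW L M (k + 1) m layer a' * JpcT L M k - JpcT L M k * SGW L M k m layer a')
        * (calDalev L M a ha k)⁻¹‖ ≤ Cst d a ^ 2 * CSGW d L m a' Cb * θ ^ k := by
  rw [mul_assoc]
  exact (opNorm_calDalev_sandwich_le L M k a ha _).trans (mul_le_mul_of_nonneg_left
    (sandwich_comm_GW_le_of_GWB L M k m layer a' hk hd hlay ha' hθ hCb (hB k hk)) (sq_nonneg _))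

/-! ## §5 THE END with `hSc` discharged modulo (GW-B) -/

/-- **THE GRADED-WELL TOWER END MODULO COERCIVITY, `‖E‖ ≤ e`, THE GRADED-MASS LAW AND (GW-B)** (`L⁻¹ ≤ θ < 1`, `layer ≤ m`, `0 < a′`,
`1 ≤ d`): the King-averaged images of the graded-well propagators on the level-`m` lattice converge at rate `θ`.  (GW-K), the column
norms, (GW-Bᵗ), the complement law, the vector Laplacian's law and the faithful torus law are THEOREMS inside. [cite: King1986, Lemma 4.5
(4.38) p.674 (shape)] [folklore] -/
theorem towerLimitRate_GW_of_GWB (hd : 1 ≤ d) (hlay : ∀ y, layer y ≤ m) (ha' : 0 < a') {γ e θ CM Cb : ℝ} (hγ : 0 < γ) (he : 0 ≤ e)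
    (hθ : (L : ℝ)⁻¹ ≤ θ) (hθ1 : θ < 1) (hCb : 0 ≤ Cb)
    (hco : ∀ k, m ≤ k → Coercive (regionGW L M k m layer a a') γ)
    (hE : ∀ k, m ≤ k → ‖EGW L M k m layer a a' ha‖ ≤ e)
    (hMc : ∀ k, m ≤ k → ‖(calDalev L M a ha (k + 1))⁻¹
        * (MGW L M (k + 1) m layer * JpcT L M k - JpcT L M k * MGW L M k m layer) * (calDalev L M a ha k)⁻¹‖ ≤ CM * θ ^ k)
    (hB : ∀ k (hk : m ≤ k), ‖BhGWL L M k m layer a' hk - JGW L M k * BhGW L M k m layer a'‖ ≤ Cb * θ ^ k) :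
    TowerLimitRate (ι := fun k => idx L M (m + k)) (fun k => Qlev L M (m + k)) ((L : ℝ) ^ d)
      (fun k => (regionGW L M (m + k) m layer a a')⁻¹)
      (Cpert 0 ((1 + γ⁻¹ * e) * (2 * d * Cst d a) * θ ^ m)
        (C1Tc d a γ e (C2GW d L a CM (Cst d a ^ 2 * CSGW d L m a' Cb)) * θ ^ m) 0 0 0) θ :=
  towerLimitRate_GW_of_laws L M m layer a a' ha hd hγ he hθ hθ1 hco hE hMc
    (fun k hk => by rw [mul_assoc (Cst d a ^ 2)]; exact
      (hSc_of_GWB L M m layer a a' ha hd hlay ha' hθ hCb hB k hk).trans (le_of_eq (by ring)))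

end Summit.QuantumFields.BalabanUV.T4Continuum.GradedWellSandwichLaw

end
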